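import Mathlib
import HarnessLib

/-!
# Bi-Lipschitz obstruction for transporting a unimodal base onto a bimodal target
# (Grenioux–Durmus–Moulines–Gabrié 2023, Proposition 3.1)

Setting [cite: GreniouxEtAl2023, §3 (footnote 6) and App. A]: the bi-Lipschitz constant
`BiLip(f)` of `f : ℝ^d → ℝ^d` is the infimum of the `M ∈ [1, ∞]` with
`M⁻¹ ‖z − z'‖ ≤ ‖f z − f z'‖ ≤ M ‖z − z'‖` for all `z ≠ z'` — in Mathlib terms, of the `M` with
`LipschitzWith M f ∧ AntilipschitzWith M f`.

**Proposition 3.1** [cite: GreniouxEtAl2023, Prop. 3.1] (verbatim up to notation).  Let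
`π = ½ N(−a, σ²) + ½ N(a, σ²)` with `a > 0`, `σ > 0`, and `ρ = N(0, 1)`.  The unique increasing
flow `T_{π,ρ}` mapping `π` to `ρ` verifies
`BiLip(T_{π,ρ}) ≥ (dT_{π,ρ}⁻¹/dz)(0) = σ · exp(a² / (2σ²))`.
("… showing the exponential scaling of the bi-Lipschitz constant in the distance between modes";
the companion qualitative statement is [cite: CornishEtAl2020, Thm 2.1]: between laws whose
supports are not homeomorphic no bi-Lipschitz — indeed no homeomorphic — transport exists.)

Typing notes.  (i) "`BiLip(T) ≥ c`" is typed as: every `M` that is simultaneously a Lipschitz and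
an antilipschitz constant of `T` satisfies `c ≤ M` (this is the definition of the infimum bound and
avoids introducing a `BiLip` functional).  (ii) "The unique increasing flow mapping `π` to `ρ`" is
typed as ANY strictly increasing `T : ℝ → ℝ` with `T_* π = ρ` (such a map is unique on `ℝ`, both
laws having positive continuous densities; the printed inequality is stated for it).  (iii) The
middle term `(dT⁻¹/dz)(0)` of the printed display is the route of the printed proof (App. A:
`BiLip(T) ≥ Lip(T⁻¹) ≥ (T⁻¹)'(0) = σ e^{a²/2σ²}`) and is not part of the typed conclusion.
(iv) Laws are Mathlib's `ProbabilityTheory.gaussianReal m v` (`v : ℝ≥0` the variance).  The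
named fact is PROVED in this file (`GreniouxEtAl2023_biLipschitzLowerBound_holds`, section
`Proof`, following the printed route through the symmetry point `T 0 = 0`); the venture
`LatticeQCDFlow` (cell pub-lqcd) uses it as the printed model for its conjecture C2 (flows onto
laws with separated topological sectors need bi-Lipschitz constants exponential in the barrier).
-/

namespace Literature.Probability.TransportMaps

open _root_.MeasureTheory _root_.ProbabilityTheory
open scoped NNReal ENNReal

/-- The symmetric two-component Gaussian mixture `½ N(−a, σ²) + ½ N(a, σ²)` on `ℝ`
(the target `π` of [cite: GreniouxEtAl2023, Prop. 3.1]), as a measure. -/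
noncomputable def twoGaussianMixture (a σ : ℝ) : Measure ℝ :=
  (2 : ℝ≥0∞)⁻¹ • gaussianReal (-a) (σ ^ 2).toNNReal + (2 : ℝ≥0∞)⁻¹ • gaussianReal a (σ ^ 2).toNNReal

/-- The mixture is a probability measure (each component is, and the weights are `½ + ½`)
[cite: GreniouxEtAl2023, Prop. 3.1 (π is a probability law)]. -/
instance isProbabilityMeasure_twoGaussianMixture (a σ : ℝ) :
    IsProbabilityMeasure (twoGaussianMixture a σ) := by
  refine ⟨?_⟩
  simp only [twoGaussianMixture, Measure.coe_add, Measure.coe_smul, Pi.add_apply, Pi.smul_apply,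
    measure_univ, smul_eq_mul, mul_one]
  rw [ENNReal.inv_two_add_inv_two]

/-- **Grenioux–Durmus–Moulines–Gabrié, Proposition 3.1** [cite: GreniouxEtAl2023, Prop. 3.1], as
printed: for `a > 0`, `σ > 0`, the increasing transport map `T` of
`π = ½ N(−a, σ²) + ½ N(a, σ²)` onto `ρ = N(0, 1)` has bi-Lipschitz constant at least
`σ · exp(a² / (2σ²))` — every `M` that is both a Lipschitz and an antilipschitz constant of such a
`T` satisfies `σ · exp(a²/(2σ²)) ≤ M`. -/
def GreniouxEtAl2023_biLipschitzLowerBound : Prop :=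
  ∀ (a σ : ℝ), 0 < a → 0 < σ →
    ∀ (T : ℝ → ℝ) (M : ℝ≥0), StrictMono T →
      (twoGaussianMixture a σ).map T = gaussianReal 0 1 →
      LipschitzWith M T → AntilipschitzWith M T →
      σ * Real.exp (a ^ 2 / (2 * σ ^ 2)) ≤ (M : ℝ)


/-! ## Proof of Proposition 3.1 (discharge of the named fact)

The printed proof [cite: GreniouxEtAl2023, App. A] computes `(T⁻¹)'(0) = σ e^{a²/2σ²}` for the
explicit increasing map `T = Φ⁻¹ ∘ F_π`.  The formal proof below follows the same route without
derivatives: (1) by the symmetry of `π` and of `N(0,1)`, `T 0 = 0` (both laws give mass `½` to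
`(−∞, 0]`, and `N(0,1)` gives mass `½` to `(−∞, c]` only for `c = 0`); (2) for `0 < h ≤ a` the
interval `[T(−h), T h]` has `N(0,1)`-mass equal to `π[−h, h]` (transport + strict monotonicity);
(3) that mass is at least `|[T(−h), T h]| · φ(M h) ≥ (2h/M) φ(Mh)` (Lipschitz keeps the interval
inside `[−Mh, Mh]`, antilipschitz makes it long) and `π[−h, h] ≤ 2h · p_σ(a − h)`, where
`φ`, `p_σ` are the normal densities; (4) letting `h → 0⁺` gives `φ(0)/M ≤ π`-density at `0`,
i.e. `σ e^{a²/2σ²} ≤ M`. -/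

section Proof

open Set Filter Topology

variable {a σ : ℝ}

/-- `σ > 0 ⇒ σ²` as an `ℝ≥0` variance is nonzero (plumbing) [folklore]. -/
private lemma var_ne_zero (hσ : 0 < σ) : (σ ^ 2).toNNReal ≠ 0 := by
  have : 0 < σ ^ 2 := by positivity
  intro h
  rw [Real.toNNReal_eq_zero] at h
  linarith

/-- Coercion of the `ℝ≥0` variance back to `ℝ` (plumbing) [folklore]. -/
private lemma coe_var (σ : ℝ) : (((σ ^ 2).toNNReal : ℝ≥0) : ℝ) = σ ^ 2 :=
  Real.coe_toNNReal _ (sq_nonneg σ)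

/-- Symmetry: `N(−m, v)(−∞,0] + N(m, v)(−∞,0] = 1` (reflection `x ↦ −x`) [folklore]. -/
private lemma gauss_Iic_add (m : ℝ) {v : ℝ≥0} (hv : v ≠ 0) :
    gaussianReal (-m) v (Iic 0) + gaussianReal m v (Iic 0) = 1 := by
  have h1 : gaussianReal (-m) v (Iic 0) = gaussianReal m v (Ici 0) := by
    rw [← gaussianReal_map_neg, Measure.map_apply measurable_neg measurableSet_Iic]
    congr 1
    ext x
    simp
  rw [h1]
  haveI := nullSingletonClass_gaussianReal (μ := m) hv
  have hu := measure_union_add_inter (μ := gaussianReal m v) (Ici (0 : ℝ))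
    (measurableSet_Iic : MeasurableSet (Iic (0 : ℝ)))
  have hunion : Ici (0 : ℝ) ∪ Iic 0 = univ := by
    ext x
    simp only [mem_union, mem_Ici, mem_Iic, mem_univ, iff_true]
    exact le_total 0 x
  have hinter : Ici (0 : ℝ) ∩ Iic 0 = {0} := by
    ext x
    simp only [mem_inter_iff, mem_Ici, mem_Iic, mem_singleton_iff]
    constructor
    · rintro ⟨h0, h1⟩; exact le_antisymm h1 h0
    · rintro rfl; exact ⟨le_rfl, le_rfl⟩
  rw [hunion, hinter, measure_univ, measure_singleton, add_zero] at hu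
  exact hu.symm

/-- `π(−∞, 0] = ½` for the symmetric mixture [folklore]. -/
private lemma mixture_Iic_zero (a : ℝ) (hσ : 0 < σ) :
    twoGaussianMixture a σ (Iic 0) = 2⁻¹ := by
  have h := gauss_Iic_add a (var_ne_zero hσ)
  simp only [twoGaussianMixture, Measure.coe_add, Measure.coe_smul, Pi.add_apply, Pi.smul_apply,
    smul_eq_mul]
  rw [← mul_add, h, mul_one]

/-- `N(0,1)(−∞, 0] = ½` [folklore]. -/
private lemma std_Iic_zero : gaussianReal 0 1 (Iic 0) = 2⁻¹ := by
  have h := gauss_Iic_add 0 (one_ne_zero : (1 : ℝ≥0) ≠ 0)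
  rw [neg_zero, ← two_mul] at h
  rw [← one_div, ENNReal.eq_div_iff two_ne_zero ENNReal.ofNat_ne_top]
  exact h

/-- `N(0,1)` charges every nonempty interval `(u, w]` (it dominates Lebesgue measure) [folklore]. -/
private lemma std_Ioc_ne_zero {u w : ℝ} (huw : u < w) : gaussianReal 0 1 (Ioc u w) ≠ 0 := by
  intro h0
  have hac := gaussianReal_absolutelyContinuous' 0 (one_ne_zero : (1 : ℝ≥0) ≠ 0)
  have hvol : volume (Ioc u w) = 0 := hac h0
  rw [Real.volume_Ioc] at hvol
  have : (0 : ℝ) < w - u := sub_pos.mpr huw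
  rw [ENNReal.ofReal_eq_zero] at hvol
  linarith

/-- `N(0,1)(−∞, c] = ½` forces `c = 0` (the median of the standard normal is unique) [folklore]. -/
private lemma std_Iic_eq_half {c : ℝ} (hc : gaussianReal 0 1 (Iic c) = 2⁻¹) : c = 0 := by
  rcases lt_trichotomy c 0 with hlt | heq | hgt
  · exfalso
    have hsplit : gaussianReal 0 1 (Iic 0) = gaussianReal 0 1 (Iic c) + gaussianReal 0 1 (Ioc c 0) := by
      rw [← measure_union _ measurableSet_Ioc, Iic_union_Ioc_eq_Iic hlt.le]
      exact Iic_disjoint_Ioc le_rfl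
    rw [std_Iic_zero, hc] at hsplit
    have hlt' : (2⁻¹ : ℝ≥0∞) < 2⁻¹ + gaussianReal 0 1 (Ioc c 0) :=
      ENNReal.lt_add_right (by simp) (std_Ioc_ne_zero hlt)
    exact absurd hsplit (ne_of_lt hlt')
  · exact heq
  · exfalso
    have hsplit : gaussianReal 0 1 (Iic c) = gaussianReal 0 1 (Iic 0) + gaussianReal 0 1 (Ioc 0 c) := by
      rw [← measure_union _ measurableSet_Ioc, Iic_union_Ioc_eq_Iic hgt.le]
      exact Iic_disjoint_Ioc le_rfl
    rw [std_Iic_zero, hc] at hsplit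
    have hlt' : (2⁻¹ : ℝ≥0∞) < 2⁻¹ + gaussianReal 0 1 (Ioc 0 c) :=
      ENNReal.lt_add_right (by simp) (std_Ioc_ne_zero hgt)
    exact absurd hsplit (ne_of_lt hlt')

/-- Lower density bound for `N(0,1)` on `[−R, R]`: `φ(y) ≥ φ(R)` for `|y| ≤ R` [folklore]. -/
private lemma std_pdf_ge {R y : ℝ} (hy : |y| ≤ R) :
    ENNReal.ofReal ((Real.sqrt (2 * Real.pi))⁻¹ * Real.exp (-R ^ 2 / 2)) ≤ gaussianPDF 0 1 y := by
  rw [gaussianPDF, gaussianPDFReal]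
  apply ENNReal.ofReal_le_ofReal
  simp only [NNReal.coe_one, mul_one, sub_zero]
  apply mul_le_mul_of_nonneg_left _ (by positivity)
  apply Real.exp_le_exp.mpr
  have : y ^ 2 ≤ R ^ 2 := by
    have h0 : 0 ≤ R := le_trans (abs_nonneg y) hy
    calc y ^ 2 = |y| ^ 2 := (sq_abs y).symm
      _ ≤ R ^ 2 := pow_le_pow_left₀ (abs_nonneg y) hy 2
  linarith

/-- Upper density bound for `N(m, v)`: for `x` with `d² ≤ (x − m)²` the density at `x` is at most
its value at distance `d` from the mean [folklore]. -/
private lemma gauss_pdf_le {m : ℝ} {v : ℝ≥0} (hv : v ≠ 0) {d x : ℝ} (hdx : d ^ 2 ≤ (x - m) ^ 2) :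
    gaussianPDF m v x ≤ ENNReal.ofReal ((Real.sqrt (2 * Real.pi * v))⁻¹ * Real.exp (-d ^ 2 / (2 * v))) := by
  rw [gaussianPDF, gaussianPDFReal]
  apply ENNReal.ofReal_le_ofReal
  apply mul_le_mul_of_nonneg_left _ (by positivity)
  apply Real.exp_le_exp.mpr
  have hvpos : 0 < (v : ℝ) := by
    have : (v : ℝ) ≠ 0 := by exact_mod_cast hv
    exact lt_of_le_of_ne v.coe_nonneg (Ne.symm this)
  rw [div_le_div_iff_of_pos_right (by positivity : (0 : ℝ) < 2 * v)]  -- -(x-m)^2 ≤ -d^2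
  linarith

/-- **Proposition 3.1, proved** [cite: GreniouxEtAl2023, Prop. 3.1]: the named fact
`GreniouxEtAl2023_biLipschitzLowerBound` holds. -/
theorem GreniouxEtAl2023_biLipschitzLowerBound_holds : GreniouxEtAl2023_biLipschitzLowerBound := by
  intro a σ ha hσ T M hT hmap hLip hAnti
  -- notation and basic facts
  set v : ℝ≥0 := (σ ^ 2).toNNReal with hvdef
  have hv : v ≠ 0 := var_ne_zero hσ
  have hvR : (v : ℝ) = σ ^ 2 := coe_var σ
  have hTm : Measurable T := hT.monotone.measurable
  have hTc : Continuous T := hLip.continuous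
  -- M > 0 (a strictly monotone map is not 0-Lipschitz)
  have hMpos : 0 < (M : ℝ) := by
    have h01 : T 0 < T 1 := hT (by norm_num)
    have hd : dist (T 0) (T 1) ≤ M * dist (0 : ℝ) 1 := hLip.dist_le_mul 0 1
    rw [Real.dist_eq, Real.dist_eq] at hd
    have : 0 < |T 0 - T 1| := abs_pos.mpr (sub_ne_zero.mpr (ne_of_lt h01))
    norm_num at hd
    nlinarith [this, hd]
  -- (1) T 0 = 0
  have hT0 : T 0 = 0 := by
    apply std_Iic_eq_half
    rw [← hmap, Measure.map_apply hTm measurableSet_Iic]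
    have hpre : T ⁻¹' Iic (T 0) = Iic 0 := by
      ext x
      simp only [mem_preimage, mem_Iic, hT.le_iff_le]
    rw [hpre]
    exact mixture_Iic_zero a hσ
  -- (2)–(3) the interval inequality for 0 < h ≤ a
  have key : ∀ h : ℝ, 0 < h → h ≤ a →
      (Real.sqrt (2 * Real.pi))⁻¹ * Real.exp (-((M : ℝ) * h) ^ 2 / 2) * (M : ℝ)⁻¹ ≤
        (Real.sqrt (2 * Real.pi * v))⁻¹ * Real.exp (-(a - h) ^ 2 / (2 * v)) := by
    intro h hh hha
    set u := T (-h) with hu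
    set w := T h with hw
    have huw : u < w := hT (by linarith)
    -- |T(±h)| ≤ M h
    have hwle : w ≤ M * h := by
      have := hLip.dist_le_mul h 0
      rw [hT0, Real.dist_eq, Real.dist_eq, sub_zero, sub_zero, abs_of_pos hh] at this
      exact le_trans (le_abs_self _) this
    have hule : -(M * h) ≤ u := by
      have := hLip.dist_le_mul (-h) 0
      rw [hT0, Real.dist_eq, Real.dist_eq, sub_zero, sub_zero, abs_neg, abs_of_pos hh] at this
      have : |u| ≤ M * h := this
      exact neg_le_of_abs_le this
    -- antilipschitz: w - u ≥ 2h/M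
    have hlen : (M : ℝ)⁻¹ * (2 * h) ≤ w - u := by
      have := hAnti.mul_le_dist (-h) h
      rw [NNReal.coe_inv, Real.dist_eq, Real.dist_eq, show -h - h = -(2 * h) by ring, abs_neg,
        abs_of_pos (by linarith : 0 < 2 * h), abs_of_neg (by linarith : u - w < 0)] at this
      linarith
    -- transport: N(0,1)[u,w] = π[-h,h]
    have htrans : gaussianReal 0 1 (Icc u w) = twoGaussianMixture a σ (Icc (-h) h) := by
      rw [← hmap, Measure.map_apply hTm measurableSet_Icc]
      congr 1
      ext x
      simp only [mem_preimage, mem_Icc, hu, hw, hT.le_iff_le]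
    -- lower bound on the left
    set c : ℝ := (Real.sqrt (2 * Real.pi))⁻¹ * Real.exp (-((M : ℝ) * h) ^ 2 / 2) with hc
    have hc0 : 0 ≤ c := by positivity
    have hlow : ENNReal.ofReal (c * (w - u)) ≤ gaussianReal 0 1 (Icc u w) := by
      rw [gaussianReal_apply 0 one_ne_zero, ENNReal.ofReal_mul hc0, ← Real.volume_Icc,
        ← setLIntegral_const]
      apply setLIntegral_mono' measurableSet_Icc
      intro y hy
      have hyR : |y| ≤ M * h := by
        rw [abs_le]
        exact ⟨le_trans hule hy.1, le_trans hy.2 hwle⟩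
      simpa [hc] using std_pdf_ge (R := M * h) hyR
    -- upper bound on the right
    set d : ℝ := (Real.sqrt (2 * Real.pi * v))⁻¹ * Real.exp (-(a - h) ^ 2 / (2 * v)) with hd
    have hd0 : 0 ≤ d := by positivity
    have hcomp : ∀ m : ℝ, (m = a ∨ m = -a) →
        gaussianReal m v (Icc (-h) h) ≤ ENNReal.ofReal (d * (2 * h)) := by
      intro m hm
      rw [gaussianReal_apply m hv, ENNReal.ofReal_mul hd0,
        show (2 * h) = h - (-h) by ring, ← Real.volume_Icc, ← setLIntegral_const]
      apply setLIntegral_mono' measurableSet_Icc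
      intro x hx
      have hsq : (a - h) ^ 2 ≤ (x - m) ^ 2 := by
        have h0 : 0 ≤ a - h := by linarith
        rcases hm with hm | hm
        · rw [hm]
          have h1 : a - h ≤ a - x := by linarith [hx.2]
          calc (a - h) ^ 2 ≤ (a - x) ^ 2 := pow_le_pow_left₀ h0 h1 2
            _ = (x - a) ^ 2 := by ring
        · rw [hm]
          have h1 : a - h ≤ x + a := by linarith [hx.1]
          calc (a - h) ^ 2 ≤ (x + a) ^ 2 := pow_le_pow_left₀ h0 h1 2
            _ = (x - -a) ^ 2 := by ring
      simpa [hd] using gauss_pdf_le hv hsq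
    have hup : twoGaussianMixture a σ (Icc (-h) h) ≤ ENNReal.ofReal (d * (2 * h)) := by
      simp only [twoGaussianMixture, Measure.coe_add, Measure.coe_smul, Pi.add_apply, Pi.smul_apply,
        smul_eq_mul]
      calc 2⁻¹ * gaussianReal (-a) v (Icc (-h) h) + 2⁻¹ * gaussianReal a v (Icc (-h) h)
          ≤ 2⁻¹ * ENNReal.ofReal (d * (2 * h)) + 2⁻¹ * ENNReal.ofReal (d * (2 * h)) := by
            gcongr
            · exact hcomp (-a) (Or.inr rfl)
            · exact hcomp a (Or.inl rfl)
        _ = ENNReal.ofReal (d * (2 * h)) := by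
            rw [← mul_add, ← two_mul, ← mul_assoc, ENNReal.inv_mul_cancel two_ne_zero
              ENNReal.ofNat_ne_top, one_mul]
    -- combine in ℝ
    have hchain : ENNReal.ofReal (c * (w - u)) ≤ ENNReal.ofReal (d * (2 * h)) :=
      le_trans hlow (htrans ▸ hup)
    have hreal : c * (w - u) ≤ d * (2 * h) :=
      (ENNReal.ofReal_le_ofReal_iff (by positivity)).mp hchain
    have h2h : 0 < 2 * h := by linarith
    have : c * ((M : ℝ)⁻¹ * (2 * h)) ≤ d * (2 * h) :=
      le_trans (mul_le_mul_of_nonneg_left hlen hc0) hreal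
    have : c * (M : ℝ)⁻¹ ≤ d := by
      have := div_le_div_of_nonneg_right this h2h.le
      -- rewrite (c * (M⁻¹ * (2h))) / (2h) = c * M⁻¹ and (d * 2h)/(2h) = d
      rwa [← mul_assoc, mul_div_assoc, div_self (ne_of_gt h2h), mul_one, mul_div_assoc,
        div_self (ne_of_gt h2h), mul_one] at this
    simpa [hc, hd] using this
  -- (4) let h → 0⁺
  have hlim : (Real.sqrt (2 * Real.pi))⁻¹ * Real.exp (-((M : ℝ) * 0) ^ 2 / 2) * (M : ℝ)⁻¹ ≤
      (Real.sqrt (2 * Real.pi * v))⁻¹ * Real.exp (-(a - 0) ^ 2 / (2 * v)) := by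
    have hf : Tendsto (fun h : ℝ => (Real.sqrt (2 * Real.pi))⁻¹ * Real.exp (-((M : ℝ) * h) ^ 2 / 2) *
        (M : ℝ)⁻¹) (𝓝[>] 0)
        (𝓝 ((Real.sqrt (2 * Real.pi))⁻¹ * Real.exp (-((M : ℝ) * 0) ^ 2 / 2) * (M : ℝ)⁻¹)) := by
      apply tendsto_nhdsWithin_of_tendsto_nhds
      exact ((by fun_prop : Continuous fun h : ℝ =>
        (Real.sqrt (2 * Real.pi))⁻¹ * Real.exp (-((M : ℝ) * h) ^ 2 / 2) * (M : ℝ)⁻¹).tendsto 0)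
    have hg : Tendsto (fun h : ℝ => (Real.sqrt (2 * Real.pi * v))⁻¹ *
        Real.exp (-(a - h) ^ 2 / (2 * v))) (𝓝[>] 0)
        (𝓝 ((Real.sqrt (2 * Real.pi * v))⁻¹ * Real.exp (-(a - 0) ^ 2 / (2 * v)))) := by
      apply tendsto_nhdsWithin_of_tendsto_nhds
      exact ((by fun_prop : Continuous fun h : ℝ =>
        (Real.sqrt (2 * Real.pi * v))⁻¹ * Real.exp (-(a - h) ^ 2 / (2 * v))).tendsto 0)
    apply le_of_tendsto_of_tendsto hf hg
    filter_upwards [Ioc_mem_nhdsGT ha] with h hh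
    exact key h hh.1 hh.2
  -- (5) algebra: φ(0)/M ≤ p(0) ⇒ σ e^{a²/2σ²} ≤ M
  simp only [mul_zero, sub_zero, ne_eq, OfNat.ofNat_ne_zero, not_false_eq_true, zero_pow,
    neg_zero, zero_div, Real.exp_zero, mul_one] at hlim
  rw [hvR] at hlim
  have hsqrt : Real.sqrt (2 * Real.pi * σ ^ 2) = Real.sqrt (2 * Real.pi) * σ := by
    rw [Real.sqrt_mul (by positivity) (σ ^ 2), Real.sqrt_sq hσ.le]
  rw [hsqrt] at hlim
  have hpi : 0 < Real.sqrt (2 * Real.pi) := by positivity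
  set E := Real.exp (a ^ 2 / (2 * σ ^ 2)) with hE
  have hEpos : 0 < E := Real.exp_pos _
  have hneg : Real.exp (-a ^ 2 / (2 * σ ^ 2)) = E⁻¹ := by
    rw [hE, ← Real.exp_neg]; congr 1; ring
  rw [hneg] at hlim
  -- hlim : (√(2π))⁻¹ * M⁻¹ ≤ (√(2π) * σ)⁻¹ * E⁻¹
  have h1 : (Real.sqrt (2 * Real.pi))⁻¹ * (M : ℝ)⁻¹ = 1 / (Real.sqrt (2 * Real.pi) * M) := by
    rw [one_div, mul_inv]
  have h2 : (Real.sqrt (2 * Real.pi) * σ)⁻¹ * E⁻¹ = 1 / (Real.sqrt (2 * Real.pi) * (σ * E)) := by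
    rw [one_div, mul_inv, mul_inv, mul_inv, mul_assoc]
  rw [h1, h2] at hlim
  have h3 : Real.sqrt (2 * Real.pi) * (σ * E) ≤ Real.sqrt (2 * Real.pi) * M :=
    (one_div_le_one_div (by positivity) (by positivity)).mp hlim
  exact le_of_mul_le_mul_left h3 hpi

end Proof

end Literature.Probability.TransportMaps
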